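import Mathlib
import HarnessLib
import Summits.HubbardSuperconductivity.HubbardSuperconductivity.Theorems.KLProgrammeKLRegimeEnginePairTransferMemberPHSignedRow

/-!
# Route `KLProgramme` — ENGINE item stmt-HubbardSuperconductivity-20437 `KLRegimeEngineV17F2`, class-#5 STEP (X).3 rows form: THE SIGNED DIRECT PH ROW
# FOR A GENERIC PARTNER WEIGHT (member `Φ_j(t)`, `D`-line `s_{n+1,j} − s_{n+1,j′}`, …) AND A GENERIC KERNEL — split into the frequency-pinned part and a
# flat remainder, the pinned bubble with partner `klPhiC Λ_m Λ′` (`Λ′ ∈ [Λₙ₊₁, Λₙ]`) and frequency shift, and the ADJACENT-PAIR `D`-row `Rd₁` assembled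
# (cell gate-hubbard-kl, seat hubbard-kl-k3c2-p2 g17)

WHY.  KLTC-INDEX v11.3 §E lists, besides the member classes `RP RQ RS` (…MemberPHSigned(Row), …MemberBornSigned, …MemberPHCrossedSigned(Row)), the `D`-rows
`Rd₁ Rx₁` of the ADJACENT pair `j′ = n+1` (`t > 2/3`: the `D`-line `s_{n+1,j}` meets the slice band) as needing the signed row.  The split/pinned machinery is the
same for any partner weight `w` whose line reads `w(p)·(βL²·ĝ_K p) = βL²·klfb_prop d (ω_p) (e_K k̃)` for a radial profile `d` — so this file states it ONCE
generically:

* **`klms_weighted_direct_norm_le`** — literal direct-row sum with partner weight `w`, slice `Ẇ_{Λ(t)}`, kernel `F` (resolved) / `F₀` (momentum-only pin), flatness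
  `‖F((i,k̃),σ,(i,k̃′)) − F₀(k̃,σ,k̃′)‖ ≤ ε` on `ω_i² ≤ (4Λₙ₊₁)²`:  `‖S‖ ≤ |βL²|²(‖T⁺‖ + ‖T⁻‖) + ε·(512/3)(βL²)²/Λ(t)²·Σ|w|‖ĝ‖`;
* **`klms_pinned_bubble_norm_le_gen`** — `‖Σ_p Y(k̃)·Φ_Ẇ(ω_p, e_K k̃)·Φ_d(ω_p + q₀, e_K(k̃+q̃))‖ ≤ βL²·klmsRowBound d A G A₀ L_A β n m (|q₀| + G|p_q̃|_𝕋) L` for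
  `d = klPhiC Λ_m Λ′`, `n+1 ≤ m`, `Λ′ ∈ [Λₙ₊₁, Λₙ]`, `|q₀| ≤ Λₙ₊₁/8`;
* `klms_weighted_direct_eq_near` — two partner weights differing by `s_{n+1,j} − s_{n+1,n+2}` (`n+2 ≤ j`) give the SAME literal sum at small transfer;
* **`klms_dLine_adjacent_direct_signed_le`** — the `D`-row `Rd₁` of the pair `(m, n+1)`, `n+1 ≤ m` (`D = s_{n+1,m} − s_{n+1,n+1}`, profile `klPhiC Λ_m Λₙ₊₁`):
  `‖S_D‖ ≤ (βL²)²(βL²·Row(G|p_{x−y}|) + βL²·Row(G|p_{y−x}|)) + ε·flat` keyed on lattice kernel data (deep `j` reduce to `m = n+2` by `…_eq_near`).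

Pure composition over landed rows; nothing about the model's effective action is asserted; nothing asserts (X).3, (c), K3 or superconductivity.
-/

noncomputable section

namespace Summit.HubbardSuperconductivity.HubbardSuperconductivity.Theorems.KLRegimeSplit

set_option linter.dupNamespace false -- summit = problem name (single-conjunct summit), D-0017

open Real Set Finset Complex Literature.MathematicalPhysics.QuantumLattice
open Literature.Probability.LatticeModels hiding torusSupNorm
open Literature.MathematicalPhysics.QuantumLattice.BandSectorCounting
open Summit.HubbardSuperconductivity.HubbardSuperconductivity.Theorems.KLProgrammeLegKernels
open Summit.HubbardSuperconductivity.HubbardSuperconductivity.Theorems.KLRegimeWick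
open Summit.HubbardSuperconductivity.HubbardSuperconductivity.Theorems.TwoPointAssembly
open Summit.HubbardSuperconductivity.HubbardSuperconductivity.Theorems.DispersionFlow
open Summit.HubbardSuperconductivity.HubbardSuperconductivity.Theorems.PerturbedFermiCurve

variable {L M : ℕ} [NeZero L] [NeZero M] (β μ : ℝ) (K : TrigPolyC4v)

/-! ## §1 The generic direct row: pinned part + flat remainder -/

/-- **GENERIC SIGNED DIRECT ROW, SPLIT.**  Partner weight `w` with radial profile `d` (line identity `hwd`), slice `Ẇ_{Λ(t)}` (pin `hWd`), resolved kernel `F`,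
momentum-only pin `F₀`, flatness `ε` on the window `ω² ≤ (4Λₙ₊₁)²`. -/
theorem klms_weighted_direct_norm_le (hβ : 0 < β) (n : ℕ) {t : ℝ} (ht : t ∈ Icc (0 : ℝ) 1)
    (w : FreqMomentum L M → ℝ) (d : ℝ → ℂ)
    (hwd : ∀ p : FreqMomentum L M, (((w p : ℝ)) : ℂ) * ((((β * (L : ℝ) ^ 2 : ℝ)) : ℂ) * propCT L M β μ K p) =
      (((β * (L : ℝ) ^ 2 : ℝ)) : ℂ) * klfb_prop d (matsubaraFreq β M p.1) (nambuXiCT L μ K p.2))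
    (Wd : ℝ → FreqMomentum L M → ℝ) (hWd : Wd = fun t k => deriv (fun Λ' : ℝ => hubbardCutoffWeightCT L M β μ K Λ' k) (klScale klE0 n + t * (klScale klE0 (n + 1) - klScale klE0 n)))
    (F : FreqMomentum L M → Fin 2 → FreqMomentum L M → ℂ) (F₀ : TorusSite 2 L → Fin 2 → TorusSite 2 L → ℂ) (x y : TorusSite 2 L) {ε : ℝ} (hε : 0 ≤ ε)
    (hflat : ∀ (i : MatsubaraIdx M) (σ : Fin 2) (k k' : TorusSite 2 L), matsubaraFreq β M i ^ 2 ≤ (4 * klScale klE0 (n + 1)) ^ 2 →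
      ‖F (i, k) σ (i, k') - F₀ k σ k'‖ ≤ ε) :
    ‖∑ p : FreqMomentum L M, ∑ σ : Fin 2, ∑ p' : FreqMomentum L M,
        if matsubaraInt M p'.1 + matsubaraInt M (omega0 M) = matsubaraInt M p.1 + matsubaraInt M (omega0 M) ∧ p'.2 = p.2 + x - y then
          ((((((w p) : ℝ) : ℂ) * (((β * (L : ℝ) ^ 2 : ℝ) : ℂ) * propCT L M β μ K p)) * ((((Wd t p') : ℝ) : ℂ) * (((β * (L : ℝ) ^ 2 : ℝ) : ℂ) * propCT L M β μ K p'))) +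
              (((((Wd t p) : ℝ) : ℂ) * (((β * (L : ℝ) ^ 2 : ℝ) : ℂ) * propCT L M β μ K p)) * ((((w p') : ℝ) : ℂ) * (((β * (L : ℝ) ^ 2 : ℝ) : ℂ) * propCT L M β μ K p')))) *
            F p σ p'
        else 0‖ ≤
      (β * (L : ℝ) ^ 2) ^ 2 *
          (‖∑ p : FreqMomentum L M, (∑ σ : Fin 2, F₀ p.2 σ (p.2 + (x - y))) *
                (klfb_prop (klWdC (klScale klE0 n + t * (klScale klE0 (n + 1) - klScale klE0 n))) (matsubaraFreq β M p.1) (nambuXiCT L μ K p.2) *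
                  klfb_prop d (matsubaraFreq β M p.1) (nambuXiCT L μ K (p.2 + (x - y))))‖ +
            ‖∑ p : FreqMomentum L M, (∑ σ : Fin 2, F₀ (p.2 + -(x - y)) σ p.2) *
                (klfb_prop (klWdC (klScale klE0 n + t * (klScale klE0 (n + 1) - klScale klE0 n))) (matsubaraFreq β M p.1) (nambuXiCT L μ K p.2) *
                  klfb_prop d (matsubaraFreq β M p.1) (nambuXiCT L μ K (p.2 + -(x - y))))‖) +
        ε * (512 / 3 * (β * (L : ℝ) ^ 2) ^ 2 / (klScale klE0 n + t * (klScale klE0 (n + 1) - klScale klE0 n)) ^ 2 *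
          ∑ p : FreqMomentum L M, |w p| * ‖propCT L M β μ K p‖) := by
  set Λt : ℝ := klScale klE0 n + t * (klScale klE0 (n + 1) - klScale klE0 n) with hΛt
  obtain ⟨hlo, hhi⟩ := scaleAt_mem n ht
  have hΛpos : 0 < Λt := (klth_klScale_pos (n + 1)).trans_le hlo
  set X₀ : FreqMomentum L M → Fin 2 → FreqMomentum L M → ℂ := fun p σ p' => F₀ p.2 σ p'.2 with hX₀
  set G : FreqMomentum L M → ℂ := fun p => (((β * (L : ℝ) ^ 2 : ℝ)) : ℂ) * propCT L M β μ K p with hG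
  set ln : FreqMomentum L M → FreqMomentum L M → ℂ := fun p p' =>
    (((w p : ℝ)) : ℂ) * G p * ((((Wd t p' : ℝ)) : ℂ) * G p') + (((Wd t p : ℝ)) : ℂ) * G p * ((((w p' : ℝ)) : ℂ) * G p') with hln
  set C : FreqMomentum L M → FreqMomentum L M → Prop := fun p p' =>
    matsubaraInt M p'.1 + matsubaraInt M (omega0 M) = matsubaraInt M p.1 + matsubaraInt M (omega0 M) ∧ p'.2 = p.2 + x - y with hC
  have hgoal : (∑ p : FreqMomentum L M, ∑ σ : Fin 2, ∑ p' : FreqMomentum L M,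
        if matsubaraInt M p'.1 + matsubaraInt M (omega0 M) = matsubaraInt M p.1 + matsubaraInt M (omega0 M) ∧ p'.2 = p.2 + x - y then
          ((((((w p) : ℝ) : ℂ) * (((β * (L : ℝ) ^ 2 : ℝ) : ℂ) * propCT L M β μ K p)) * ((((Wd t p') : ℝ) : ℂ) * (((β * (L : ℝ) ^ 2 : ℝ) : ℂ) * propCT L M β μ K p'))) +
              (((((Wd t p) : ℝ) : ℂ) * (((β * (L : ℝ) ^ 2 : ℝ) : ℂ) * propCT L M β μ K p)) * ((((w p') : ℝ) : ℂ) * (((β * (L : ℝ) ^ 2 : ℝ) : ℂ) * propCT L M β μ K p')))) *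
            F p σ p'
        else 0) =
      (∑ p : FreqMomentum L M, ∑ σ : Fin 2, ∑ p' : FreqMomentum L M, if C p p' then ln p p' * X₀ p σ p' else 0) +
        ∑ p : FreqMomentum L M, ∑ σ : Fin 2, ∑ p' : FreqMomentum L M, if C p p' then ln p p' * (F p σ p' - X₀ p σ p') else 0 := by
    rw [← Finset.sum_add_distrib]
    refine Finset.sum_congr rfl fun p _ => ?_
    rw [← Finset.sum_add_distrib]
    refine Finset.sum_congr rfl fun σ _ => ?_
    rw [← Finset.sum_add_distrib]
    refine Finset.sum_congr rfl fun p' _ => ?_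
    simp only [hC]
    split_ifs
    · simp only [hln, hG]; ring
    · simp
  rw [hgoal]
  refine (norm_add_le _ _).trans (add_le_add ?_ ?_)
  · -- pinned part
    have h := klrf_direct_sum_eq w (Wd t) G X₀ x y
    have hln' : ∀ p p', ln p p' = (((w p : ℝ)) : ℂ) * G p * ((((Wd t p' : ℝ)) : ℂ) * G p') + (((Wd t p : ℝ)) : ℂ) * G p * ((((w p' : ℝ)) : ℂ) * G p') :=
      fun p p' => rfl
    simp only [hC]
    simp_rw [hln']
    rw [h]
    have hlines : ∀ (p : FreqMomentum L M) (k' : TorusSite 2 L),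
        (((Wd t p : ℝ)) : ℂ) * G p * ((((w (p.1, k') : ℝ)) : ℂ) * G (p.1, k')) =
          (((β * (L : ℝ) ^ 2 : ℝ)) : ℂ) ^ 2 *
            (klfb_prop (klWdC Λt) (matsubaraFreq β M p.1) (nambuXiCT L μ K p.2) * klfb_prop d (matsubaraFreq β M p.1) (nambuXiCT L μ K k')) := by
      intro p k'
      have h1 : (((Wd t p : ℝ)) : ℂ) * G p = (((β * (L : ℝ) ^ 2 : ℝ)) : ℂ) * klfb_prop (klWdC Λt) (matsubaraFreq β M p.1) (nambuXiCT L μ K p.2) := by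
        simp only [hG, hWd]; exact klfw_sliceLine_eq μ K hβ.ne' hΛpos.ne' p
      have h2 := hwd (p.1, k')
      simp only [hG] at h1 ⊢
      rw [h1, h2]
      ring
    have e1 : (∑ p : FreqMomentum L M, (((Wd t p : ℝ)) : ℂ) * G p * ((((w (p.1, p.2 + (x - y)) : ℝ)) : ℂ) * G (p.1, p.2 + (x - y))) *
          ∑ σ : Fin 2, X₀ p σ (p.1, p.2 + (x - y))) =
        (((β * (L : ℝ) ^ 2 : ℝ)) : ℂ) ^ 2 * ∑ p : FreqMomentum L M, (∑ σ : Fin 2, F₀ p.2 σ (p.2 + (x - y))) *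
          (klfb_prop (klWdC Λt) (matsubaraFreq β M p.1) (nambuXiCT L μ K p.2) * klfb_prop d (matsubaraFreq β M p.1) (nambuXiCT L μ K (p.2 + (x - y)))) := by
      rw [Finset.mul_sum]; exact Finset.sum_congr rfl fun p _ => by rw [hlines]; simp only [hX₀]; ring
    have e2 : (∑ p : FreqMomentum L M, (((Wd t p : ℝ)) : ℂ) * G p * ((((w (p.1, p.2 + -(x - y)) : ℝ)) : ℂ) * G (p.1, p.2 + -(x - y))) *
          ∑ σ : Fin 2, X₀ (p.1, p.2 + -(x - y)) σ p) =
        (((β * (L : ℝ) ^ 2 : ℝ)) : ℂ) ^ 2 * ∑ p : FreqMomentum L M, (∑ σ : Fin 2, F₀ (p.2 + -(x - y)) σ p.2) *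
          (klfb_prop (klWdC Λt) (matsubaraFreq β M p.1) (nambuXiCT L μ K p.2) * klfb_prop d (matsubaraFreq β M p.1) (nambuXiCT L μ K (p.2 + -(x - y)))) := by
      rw [Finset.mul_sum]; exact Finset.sum_congr rfl fun p _ => by rw [hlines]; simp only [hX₀]; ring
    rw [e1, e2]
    have hnorm : ‖(((β * (L : ℝ) ^ 2 : ℝ)) : ℂ) ^ 2‖ = (β * (L : ℝ) ^ 2) ^ 2 := by
      rw [norm_pow, Complex.norm_real, Real.norm_of_nonneg (by positivity)]
    refine (norm_add_le _ _).trans ?_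
    rw [norm_mul, norm_mul, hnorm, ← mul_add]
  · -- flat remainder
    have hterm : ∀ (p : FreqMomentum L M) (σ : Fin 2) (p' : FreqMomentum L M),
        ‖(if C p p' then ln p p' * (F p σ p' - X₀ p σ p') else 0)‖ ≤ ε * (if C p p' then ‖ln p p'‖ else 0) := by
      intro p σ p'
      simp only [hC]
      split_ifs with hc
      · obtain ⟨hω, hk⟩ := hc
        have h1' : p'.1 = p.1 := by
          have h3 : matsubaraInt M p'.1 = matsubaraInt M p.1 := by linarith
          simp only [matsubaraInt] at h3
          exact Fin.ext (by omega)
        by_cases hwin : matsubaraFreq β M p.1 ^ 2 ≤ (4 * klScale klE0 (n + 1)) ^ 2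
        · rw [norm_mul, mul_comm]
          refine mul_le_mul_of_nonneg_right ?_ (norm_nonneg _)
          have hp : p = (p.1, p.2) := rfl
          have hp' : p' = (p.1, p'.2) := Prod.ext h1' rfl
          have h := hflat p.1 σ p.2 p'.2 hwin
          simp only [hX₀]
          rw [hp', hp]
          exact h
        · have hω' : (4 * klScale klE0 (n + 1)) ^ 2 < matsubaraFreq β M p.1 ^ 2 := not_le.mp hwin
          have hz : Wd t p = 0 := by simp only [hWd]; exact klms_Wd_eq_zero_of_freq β μ K n hlo hhi p hω'
          have hz' : Wd t p' = 0 := by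
            simp only [hWd]; refine klms_Wd_eq_zero_of_freq β μ K n hlo hhi p' ?_; rw [h1']; exact hω'
          have hln0 : ln p p' = 0 := by simp only [hln, hz, hz']; simp
          rw [hln0]
          simp
      · simp
    calc ‖∑ p : FreqMomentum L M, ∑ σ : Fin 2, ∑ p' : FreqMomentum L M, (if C p p' then ln p p' * (F p σ p' - X₀ p σ p') else 0)‖
        ≤ ∑ p : FreqMomentum L M, ∑ σ : Fin 2, ∑ p' : FreqMomentum L M, ε * (if C p p' then ‖ln p p'‖ else 0) :=
          (norm_sum_le _ _).trans (Finset.sum_le_sum fun p _ => (norm_sum_le _ _).trans (Finset.sum_le_sum fun σ _ =>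
            (norm_sum_le _ _).trans (Finset.sum_le_sum fun p' _ => hterm p σ p')))
      _ = ε * ∑ p : FreqMomentum L M, ∑ _σ : Fin 2, ∑ p' : FreqMomentum L M, (if C p p' then ‖ln p p'‖ else 0) := by
          simp only [Finset.mul_sum]
      _ ≤ ε * (512 / 3 * (β * (L : ℝ) ^ 2) ^ 2 / Λt ^ 2 * ∑ p : FreqMomentum L M, |w p| * ‖propCT L M β μ K p‖) := by
          refine mul_le_mul_of_nonneg_left ?_ hε
          have h := direct_mass_le_softSum β μ K hβ hΛpos w x y
          subst hWd
          simpa only [hC, hln, hG] using h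

/-! ## §2 The pinned bubble with partner `klPhiC Λ_m Λ′`, `Λ′ ∈ [Λₙ₊₁, Λₙ]`, and a frequency shift -/

section Model

variable {a' b' : ℝ} (B : BandBounds a' b') {R : RenConsts} {U : ℝ} {N : ℕ} {A : ℝ}

omit [NeZero M] in
/-- **PINNED BUBBLE, general partner scale**: `d = klPhiC Λ_m Λ′` with `n+1 ≤ m`, `Λₙ₊₁ ≤ Λ′ ≤ Λₙ`, shift `|q₀| ≤ Λₙ₊₁/8`, momentum-only weight `Y` (`A₀`, `L_A`):
`‖Σ_p Y(k̃)·Φ_Ẇ(ω_p, e_K k̃)·Φ_d(ω_p + q₀, e_K(k̃ + q̃))‖ ≤ βL²·klmsRowBound d A G A₀ L_A β n m (|q₀| + G|p_q̃|_𝕋) L`. -/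
theorem klms_pinned_bubble_norm_le_gen (hR : ∀ j, 0 ≤ R.Gfr j) (hK : FrameOK R U N μ K)
    (hAb : ∀ p : Momentum, ∀ j ≤ 2, ‖iteratedFDeriv ℝ j (frameShift K) p‖ ≤ A) (hA : 4 * A < B.Dtmin) (hA20 : 4 * A ≤ 1 / 20) (hμ : μ ≤ -0.15)
    (n : ℕ) {t : ℝ} (ht : t ∈ Icc (0 : ℝ) 1) {m : ℕ} (hm : n + 1 ≤ m) {Λ' : ℝ} (hlo'' : klScale klE0 (n + 1) ≤ Λ') (hhi'' : Λ' ≤ klScale klE0 n)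
    (hlo : a' < μ - 4 * klScale klE0 (n + 1) - 4 * A) (hhi : μ + 4 * klScale klE0 (n + 1) + 4 * A < b')
    (hβ : klBetaMin ≤ β) (hn : n + 1 ≤ nScales β + 1) (hM : β * (4 * klScale klE0 (n + 1)) / (2 * Real.pi) + 1 ≤ M)
    (q : TorusSite 2 L) (hq : (4 + 8 / 3 * R.Gfr 1 * U ^ 2) * klTorusNorm L q ≤ klScale klE0 (n + 1) / 8) {q₀ : ℝ} (hq₀ : |q₀| ≤ klScale klE0 (n + 1) / 8)
    {Y : TorusSite 2 L → ℂ} {A₀ LA : ℝ} (hA0 : 0 ≤ A₀) (hLA : 0 ≤ LA) (hY0 : ∀ k, ‖Y k‖ ≤ A₀)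
    (hY1 : ∀ k k', ‖Y k - Y k'‖ ≤ LA * klTorusNorm L (k - k')) :
    ‖∑ p : FreqMomentum L M, Y p.2 *
        (klfb_prop (klWdC (klScale klE0 n + t * (klScale klE0 (n + 1) - klScale klE0 n))) (matsubaraFreq β M p.1) (nambuXiCT L μ K p.2) *
          klfb_prop (klPhiC (klScale klE0 m) Λ') (matsubaraFreq β M p.1 + q₀) (nambuXiCT L μ K (p.2 + q)))‖ ≤
      β * (L : ℝ) ^ 2 * klmsRowBound B.Dtmin A (4 + 8 / 3 * R.Gfr 1 * U ^ 2) A₀ LA β n m (|q₀| + (4 + 8 / 3 * R.Gfr 1 * U ^ 2) * klTorusNorm L q) L := by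
  set Λt : ℝ := klScale klE0 n + t * (klScale klE0 (n + 1) - klScale klE0 n) with hΛt
  obtain ⟨hlo', hhi'⟩ := scaleAt_mem n ht
  have hΛ1 := klth_klScale_pos (n + 1)
  have hβ0 : 0 < β := lt_of_lt_of_le (by norm_num [klBetaMin]) hβ
  set a : ℝ × ℝ → ℂ := klpeExt Y A₀ LA with ha
  obtain ⟨hbd, hlip, hin, hout⟩ := klfw_sliceWeight_hypotheses hlo' hhi'
  obtain ⟨hdbd, hdlip, hdout, -⟩ := klfw_partner_hypotheses hlo'' hhi'' hm
  have hFbd : ∀ s, ‖klWdC Λt s * klPhiC (klScale klE0 m) Λ' s‖ ≤ 8 / klScale klE0 (n + 1) := fun s =>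
    (klwt_mul_norm_le hbd hdbd s).trans (by rw [mul_one])
  have hFlip := klwt_mul_lipschitz hbd hdbd hlip hdlip
  have hLf' : 8 / klScale klE0 m ^ 2 ≤ 8 * (16 : ℝ) ^ (m - (n + 1)) / klScale klE0 (n + 1) ^ 2 := (klfw_partner_lipschitz_scale hm).le
  have hLF : 8 / klScale klE0 (n + 1) * (8 / klScale klE0 m ^ 2) + 1 * ((2 * (448 / 3 * Real.exp 2) + 8) / klScale klE0 (n + 1) / klScale klE0 (n + 1) ^ 2) ≤
      (8 / klScale klE0 (n + 1) * (8 / klScale klE0 m ^ 2) + 1 * ((2 * (448 / 3 * Real.exp 2) + 8) / klScale klE0 (n + 1) / klScale klE0 (n + 1) ^ 2)) *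
          klScale klE0 (n + 1) ^ 2 / klScale klE0 (n + 1) ^ 2 :=
    le_of_eq (by rw [mul_div_cancel_right₀ _ (pow_ne_zero 2 hΛ1.ne')])
  have h := klfl_lattice_soft_bubble_norm_le_model B hR hK hAb hA hA20 hμ (klpe_continuous_ext Y A₀ hLA) (klpe_ext_periodic₁ Y A₀ LA)
    (klpe_ext_periodic₂ Y A₀ LA) (klpe_norm_ext_le Y hA0 LA) (klpe_ext_lipschitz Y A₀ hLA) (n := n + 1) (Nat.le_add_left 1 n) q hq
    hlip hbd le_rfl hin hout hdlip hdbd hLf' hdout (by positivity) hFlip hFbd hLF hlo hhi hq₀ hβ hn hM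
  have hsum : (∑ p : FreqMomentum L M, Y p.2 *
        (klfb_prop (klWdC Λt) (matsubaraFreq β M p.1) (nambuXiCT L μ K p.2) *
          klfb_prop (klPhiC (klScale klE0 m) Λ') (matsubaraFreq β M p.1 + q₀) (nambuXiCT L μ K (p.2 + q)))) =
      (((β * (L : ℝ) ^ 2 : ℝ)) : ℂ) * (β⁻¹ • ∑ i : MatsubaraIdx M, ((L ^ 2 : ℕ) : ℝ)⁻¹ • ∑ k : TorusSite 2 L,
        a (latticeMomentum L k 0, latticeMomentum L k 1) * klfb_prop (klWdC Λt) (matsubaraFreq β M i) (nambuXiCT L μ K k) *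
          klfb_prop (klPhiC (klScale klE0 m) Λ') (matsubaraFreq β M i + q₀) (nambuXiCT L μ K (k + q))) := by
    rw [← klrf_sum_freqMomentum_eq_smul hβ0.ne']
    refine Finset.sum_congr rfl fun p _ => ?_
    rw [ha, klpe_ext_apply_latticeMomentum hY0 hY1, mul_assoc]
  rw [hsum, norm_mul, Complex.norm_real, Real.norm_of_nonneg (by positivity)]
  refine mul_le_mul_of_nonneg_left ?_ (by positivity)
  unfold klmsRowBound
  rw [abs_zero, zero_add]
  exact h

end Model

/-! ## §3 The adjacent-pair `D`-row `Rd₁`, signed -/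

/-- Two partner weights differing by the deep `D`-line `s_{n+1,j} − s_{n+1,n+2}` (`n+2 ≤ j`) give the same literal direct sum at small transfer
`G|p_{x−y}|_𝕋 ≤ Λ(t)/6` (every term of the difference has a vanishing line factor, `direct_DLine_factors_eq_zero`). -/
theorem klms_weighted_direct_eq_near {R : RenConsts} (hR : ∀ j, 0 ≤ R.Gfr j) {U : ℝ} {N : ℕ} (hK : FrameOK R U N μ K) (n : ℕ) {j : ℕ}
    (hj : n + 2 ≤ j) {t : ℝ} (ht : t ∈ Icc (0 : ℝ) 1) {x y : TorusSite 2 L}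
    (hq : (4 + 8 / 3 * R.Gfr 1 * U ^ 2) * klTorusNorm L (x - y) ≤ (klScale klE0 n + t * (klScale klE0 (n + 1) - klScale klE0 n)) / 6)
    (w w' : FreqMomentum L M → ℝ)
    (hdiff : ∀ k : FreqMomentum L M, w k = w' k + (softSymbolCompl L M β μ K (n + 1) j k - softSymbolCompl L M β μ K (n + 1) (n + 2) k))
    (Wd : ℝ → FreqMomentum L M → ℝ) (hWd : Wd = fun t k => deriv (fun Λ' : ℝ => hubbardCutoffWeightCT L M β μ K Λ' k) (klScale klE0 n + t * (klScale klE0 (n + 1) - klScale klE0 n)))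
    (F : FreqMomentum L M → Fin 2 → FreqMomentum L M → ℂ) :
    (∑ p : FreqMomentum L M, ∑ σ : Fin 2, ∑ p' : FreqMomentum L M,
        if matsubaraInt M p'.1 + matsubaraInt M (omega0 M) = matsubaraInt M p.1 + matsubaraInt M (omega0 M) ∧ p'.2 = p.2 + x - y then
          ((((((w p) : ℝ) : ℂ) * (((β * (L : ℝ) ^ 2 : ℝ) : ℂ) * propCT L M β μ K p)) * ((((Wd t p') : ℝ) : ℂ) * (((β * (L : ℝ) ^ 2 : ℝ) : ℂ) * propCT L M β μ K p'))) +
              (((((Wd t p) : ℝ) : ℂ) * (((β * (L : ℝ) ^ 2 : ℝ) : ℂ) * propCT L M β μ K p)) * ((((w p') : ℝ) : ℂ) * (((β * (L : ℝ) ^ 2 : ℝ) : ℂ) * propCT L M β μ K p')))) *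
            F p σ p'
        else 0) =
      ∑ p : FreqMomentum L M, ∑ σ : Fin 2, ∑ p' : FreqMomentum L M,
        if matsubaraInt M p'.1 + matsubaraInt M (omega0 M) = matsubaraInt M p.1 + matsubaraInt M (omega0 M) ∧ p'.2 = p.2 + x - y then
          ((((((w' p) : ℝ) : ℂ) * (((β * (L : ℝ) ^ 2 : ℝ) : ℂ) * propCT L M β μ K p)) * ((((Wd t p') : ℝ) : ℂ) * (((β * (L : ℝ) ^ 2 : ℝ) : ℂ) * propCT L M β μ K p'))) +
              (((((Wd t p) : ℝ) : ℂ) * (((β * (L : ℝ) ^ 2 : ℝ) : ℂ) * propCT L M β μ K p)) * ((((w' p') : ℝ) : ℂ) * (((β * (L : ℝ) ^ 2 : ℝ) : ℂ) * propCT L M β μ K p')))) *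
            F p σ p'
        else 0 := by
  rw [← sub_eq_zero, ← Finset.sum_sub_distrib]
  refine Finset.sum_eq_zero fun p _ => ?_
  rw [← Finset.sum_sub_distrib]
  refine Finset.sum_eq_zero fun σ _ => ?_
  rw [← Finset.sum_sub_distrib]
  refine Finset.sum_eq_zero fun p' _ => ?_
  split_ifs with hc
  · obtain ⟨hω, hk⟩ := hc
    have hω' : matsubaraInt M p'.1 = matsubaraInt M p.1 := by linarith
    obtain ⟨h1, h2⟩ := direct_DLine_factors_eq_zero β μ K hR hK n le_rfl hj ht hq hω' hk
    have hW : ∀ k : FreqMomentum L M,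
        Wd t k = deriv (fun Λ' : ℝ => hubbardCutoffWeightCT L M β μ K Λ' k) (klScale klE0 n + t * (klScale klE0 (n + 1) - klScale klE0 n)) := by
      intro k; simp only [hWd]
    rw [← hW p'] at h1
    rw [← hW p] at h2
    have h1c := congrArg (fun r : ℝ => (r : ℂ)) h1
    have h2c := congrArg (fun r : ℝ => (r : ℂ)) h2
    push_cast at h1c h2c
    rw [sub_eq_zero, hdiff p, hdiff p']
    push_cast
    linear_combination ((β : ℂ) ^ 2 * (L : ℂ) ^ 4 * propCT L M β μ K p * propCT L M β μ K p' * F p σ p') * h1c +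
      ((β : ℂ) ^ 2 * (L : ℂ) ^ 4 * propCT L M β μ K p * propCT L M β μ K p' * F p σ p') * h2c
  · simp

section Adjacent

variable {a' b' : ℝ} (B : BandBounds a' b') {R : RenConsts} {U : ℝ} {N : ℕ} {A : ℝ}

/-- **THE ADJACENT-PAIR `D`-ROW `Rd₁`, SIGNED AND ASSEMBLED**: pair `(j, n+1)`, `n+1 ≤ j` (deep `j` should first be reduced to `j = n+2` by
`klms_weighted_direct_eq_near`), `D = s_{n+1,j} − s_{n+1,n+1}`, partner profile `klPhiC Λ_j Λₙ₊₁`; kernel data as in `klms_memberPH_direct_signed_le`. -/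
theorem klms_dLine_adjacent_direct_signed_le (hR : ∀ j, 0 ≤ R.Gfr j) (hK : FrameOK R U N μ K)
    (hAb : ∀ p : Momentum, ∀ j ≤ 2, ‖iteratedFDeriv ℝ j (frameShift K) p‖ ≤ A) (hA : 4 * A < B.Dtmin) (hA20 : 4 * A ≤ 1 / 20) (hμ : μ ≤ -0.15)
    (n : ℕ) {t : ℝ} (ht : t ∈ Icc (0 : ℝ) 1) (hβ : klBetaMin ≤ β) (hn : n + 1 ≤ nScales β + 1)
    (hM : β * (4 * klScale klE0 (n + 1)) / (2 * Real.pi) + 1 ≤ M)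
    (Wd : ℝ → FreqMomentum L M → ℝ) (hWd : Wd = fun t k => deriv (fun Λ' : ℝ => hubbardCutoffWeightCT L M β μ K Λ' k) (klScale klE0 n + t * (klScale klE0 (n + 1) - klScale klE0 n)))
    (V : ℕ → ℝ → (Fin 4 → HubbardFieldIdx L M) → ℂ) {j : ℕ} (hj : n + 1 ≤ j) (Qm x y : TorusSite 2 L)
    (hlo : a' < μ - 4 * klScale klE0 (n + 1) - 4 * A) (hhi : μ + 4 * klScale klE0 (n + 1) + 4 * A < b')
    (hq : (4 + 8 / 3 * R.Gfr 1 * U ^ 2) * klTorusNorm L (x - y) ≤ klScale klE0 (n + 1) / 8)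
    {A₀ LA ε : ℝ} (hA0 : 0 ≤ A₀) (hLA : 0 ≤ LA) (hε : 0 ≤ ε)
    (hY0p : ∀ k : TorusSite 2 L, ‖∑ σ : Fin 2, V j t ![(((omega0 M, k), σ), 1), (((omega0 M, k + (x - y)), σ), 0), (((omega0 M, y), 0), 0), (((omega0 M, x), 0), 1)] *
        V j t ![(((omega0 M, k), σ), 0), (((omega0 M, k + (x - y)), σ), 1), ((((omega0 M).rev, Qm - y), 1), 0), ((((omega0 M).rev, Qm - x), 1), 1)]‖ ≤ A₀)
    (hY1p : ∀ k k' : TorusSite 2 L, ‖(∑ σ : Fin 2, V j t ![(((omega0 M, k), σ), 1), (((omega0 M, k + (x - y)), σ), 0), (((omega0 M, y), 0), 0), (((omega0 M, x), 0), 1)] *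
          V j t ![(((omega0 M, k), σ), 0), (((omega0 M, k + (x - y)), σ), 1), ((((omega0 M).rev, Qm - y), 1), 0), ((((omega0 M).rev, Qm - x), 1), 1)]) -
        ∑ σ : Fin 2, V j t ![(((omega0 M, k'), σ), 1), (((omega0 M, k' + (x - y)), σ), 0), (((omega0 M, y), 0), 0), (((omega0 M, x), 0), 1)] *
          V j t ![(((omega0 M, k'), σ), 0), (((omega0 M, k' + (x - y)), σ), 1), ((((omega0 M).rev, Qm - y), 1), 0), ((((omega0 M).rev, Qm - x), 1), 1)]‖ ≤
        LA * klTorusNorm L (k - k'))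
    (hY0m : ∀ k : TorusSite 2 L, ‖∑ σ : Fin 2, V j t ![(((omega0 M, k + -(x - y)), σ), 1), (((omega0 M, k), σ), 0), (((omega0 M, y), 0), 0), (((omega0 M, x), 0), 1)] *
        V j t ![(((omega0 M, k + -(x - y)), σ), 0), (((omega0 M, k), σ), 1), ((((omega0 M).rev, Qm - y), 1), 0), ((((omega0 M).rev, Qm - x), 1), 1)]‖ ≤ A₀)
    (hY1m : ∀ k k' : TorusSite 2 L, ‖(∑ σ : Fin 2, V j t ![(((omega0 M, k + -(x - y)), σ), 1), (((omega0 M, k), σ), 0), (((omega0 M, y), 0), 0), (((omega0 M, x), 0), 1)] *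
          V j t ![(((omega0 M, k + -(x - y)), σ), 0), (((omega0 M, k), σ), 1), ((((omega0 M).rev, Qm - y), 1), 0), ((((omega0 M).rev, Qm - x), 1), 1)]) -
        ∑ σ : Fin 2, V j t ![(((omega0 M, k' + -(x - y)), σ), 1), (((omega0 M, k'), σ), 0), (((omega0 M, y), 0), 0), (((omega0 M, x), 0), 1)] *
          V j t ![(((omega0 M, k' + -(x - y)), σ), 0), (((omega0 M, k'), σ), 1), ((((omega0 M).rev, Qm - y), 1), 0), ((((omega0 M).rev, Qm - x), 1), 1)]‖ ≤
        LA * klTorusNorm L (k - k'))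
    (hflat : ∀ (i : MatsubaraIdx M) (σ : Fin 2) (k k' : TorusSite 2 L), matsubaraFreq β M i ^ 2 ≤ (4 * klScale klE0 (n + 1)) ^ 2 →
      ‖V j t ![(((i, k), σ), 1), (((i, k'), σ), 0), (((omega0 M, y), 0), 0), (((omega0 M, x), 0), 1)] *
            V j t ![(((i, k), σ), 0), (((i, k'), σ), 1), ((((omega0 M).rev, Qm - y), 1), 0), ((((omega0 M).rev, Qm - x), 1), 1)] -
          V j t ![(((omega0 M, k), σ), 1), (((omega0 M, k'), σ), 0), (((omega0 M, y), 0), 0), (((omega0 M, x), 0), 1)] *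
            V j t ![(((omega0 M, k), σ), 0), (((omega0 M, k'), σ), 1), ((((omega0 M).rev, Qm - y), 1), 0), ((((omega0 M).rev, Qm - x), 1), 1)]‖ ≤ ε) :
    ‖∑ p : FreqMomentum L M, ∑ σ : Fin 2, ∑ p' : FreqMomentum L M,
        if matsubaraInt M p'.1 + matsubaraInt M (omega0 M) = matsubaraInt M p.1 + matsubaraInt M (omega0 M) ∧ p'.2 = p.2 + x - y then
          ((((((softSymbolCompl L M β μ K (n + 1) j p - softSymbolCompl L M β μ K (n + 1) (n + 1) p) : ℝ) : ℂ) * (((β * (L : ℝ) ^ 2 : ℝ) : ℂ) * propCT L M β μ K p)) *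
                ((((Wd t p') : ℝ) : ℂ) * (((β * (L : ℝ) ^ 2 : ℝ) : ℂ) * propCT L M β μ K p'))) +
              (((((Wd t p) : ℝ) : ℂ) * (((β * (L : ℝ) ^ 2 : ℝ) : ℂ) * propCT L M β μ K p)) *
                ((((softSymbolCompl L M β μ K (n + 1) j p' - softSymbolCompl L M β μ K (n + 1) (n + 1) p') : ℝ) : ℂ) * (((β * (L : ℝ) ^ 2 : ℝ) : ℂ) * propCT L M β μ K p')))) *
            (V j t ![((p, σ), 1), ((p', σ), 0), (((omega0 M, y), 0), 0), (((omega0 M, x), 0), 1)] *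
              V j t ![((p, σ), 0), ((p', σ), 1), ((((omega0 M).rev, Qm - y), 1), 0), ((((omega0 M).rev, Qm - x), 1), 1)])
        else 0‖ ≤
      (β * (L : ℝ) ^ 2) ^ 2 *
          (β * (L : ℝ) ^ 2 * klmsRowBound B.Dtmin A (4 + 8 / 3 * R.Gfr 1 * U ^ 2) A₀ LA β n j ((4 + 8 / 3 * R.Gfr 1 * U ^ 2) * klTorusNorm L (x - y)) L +
            β * (L : ℝ) ^ 2 * klmsRowBound B.Dtmin A (4 + 8 / 3 * R.Gfr 1 * U ^ 2) A₀ LA β n j ((4 + 8 / 3 * R.Gfr 1 * U ^ 2) * klTorusNorm L (x - y)) L) +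
        ε * (512 / 3 * (β * (L : ℝ) ^ 2) ^ 2 / (klScale klE0 n + t * (klScale klE0 (n + 1) - klScale klE0 n)) ^ 2 *
          ∑ p : FreqMomentum L M, |softSymbolCompl L M β μ K (n + 1) j p - softSymbolCompl L M β μ K (n + 1) (n + 1) p| * ‖propCT L M β μ K p‖) := by
  have hβ0 : 0 < β := lt_of_lt_of_le (by norm_num [klBetaMin]) hβ
  have hΛ1 := klth_klScale_pos (n + 1)
  have hq0 : |(0 : ℝ)| ≤ klScale klE0 (n + 1) / 8 := by rw [abs_zero]; positivity
  have hhi1 : klScale klE0 (n + 1) ≤ klScale klE0 n := by rw [klth_klScale_succ]; linarith [klth_klScale_pos n]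
  have h0 := klms_weighted_direct_norm_le β μ K hβ0 n ht (fun p => softSymbolCompl L M β μ K (n + 1) j p - softSymbolCompl L M β μ K (n + 1) (n + 1) p)
    (klPhiC (klScale klE0 j) (klScale klE0 (n + 1))) (fun p => klfw_dLine_line_eq μ K hβ0.ne' n j (n + 1) p) Wd hWd
    (fun p σ p' => V j t ![((p, σ), 1), ((p', σ), 0), (((omega0 M, y), 0), 0), (((omega0 M, x), 0), 1)] *
      V j t ![((p, σ), 0), ((p', σ), 1), ((((omega0 M).rev, Qm - y), 1), 0), ((((omega0 M).rev, Qm - x), 1), 1)])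
    (fun k σ k' => V j t ![(((omega0 M, k), σ), 1), (((omega0 M, k'), σ), 0), (((omega0 M, y), 0), 0), (((omega0 M, x), 0), 1)] *
      V j t ![(((omega0 M, k), σ), 0), (((omega0 M, k'), σ), 1), ((((omega0 M).rev, Qm - y), 1), 0), ((((omega0 M).rev, Qm - x), 1), 1)])
    x y hε hflat
  have h1 := klms_pinned_bubble_norm_le_gen β μ K B hR hK hAb hA hA20 hμ n ht hj le_rfl hhi1 hlo hhi hβ hn hM (x - y) hq hq0 hA0 hLA
    (Y := fun k : TorusSite 2 L => ∑ σ : Fin 2, V j t ![(((omega0 M, k), σ), 1), (((omega0 M, k + (x - y)), σ), 0), (((omega0 M, y), 0), 0), (((omega0 M, x), 0), 1)] *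
      V j t ![(((omega0 M, k), σ), 0), (((omega0 M, k + (x - y)), σ), 1), ((((omega0 M).rev, Qm - y), 1), 0), ((((omega0 M).rev, Qm - x), 1), 1)])
    hY0p hY1p
  have hq' : (4 + 8 / 3 * R.Gfr 1 * U ^ 2) * klTorusNorm L (-(x - y)) ≤ klScale klE0 (n + 1) / 8 := by rwa [klTorusNorm_neg]
  have h2 := klms_pinned_bubble_norm_le_gen β μ K B hR hK hAb hA hA20 hμ n ht hj le_rfl hhi1 hlo hhi hβ hn hM (-(x - y)) hq' hq0 hA0 hLA
    (Y := fun k : TorusSite 2 L => ∑ σ : Fin 2, V j t ![(((omega0 M, k + -(x - y)), σ), 1), (((omega0 M, k), σ), 0), (((omega0 M, y), 0), 0), (((omega0 M, x), 0), 1)] *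
      V j t ![(((omega0 M, k + -(x - y)), σ), 0), (((omega0 M, k), σ), 1), ((((omega0 M).rev, Qm - y), 1), 0), ((((omega0 M).rev, Qm - x), 1), 1)])
    hY0m hY1m
  simp only [add_zero, abs_zero, zero_add] at h1 h2
  rw [klTorusNorm_neg] at h2
  exact h0.trans (add_le_add (mul_le_mul_of_nonneg_left (add_le_add h1 h2) (by positivity)) le_rfl)

end Adjacent

end Summit.HubbardSuperconductivity.HubbardSuperconductivity.Theorems.KLRegimeSplit

end
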